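import Literature.NumberTheory.EllipticCurves.ZpExtensionEisensteinTowerExactProofs
import Literature.NumberTheory.EllipticCurves.ZpExtensionEisensteinTwistFreeProofs
import Literature.NumberTheory.EllipticCurves.IwasawaAlgebraEisensteinQuotientDVRProofs
import HarnessLib

/-!
# Torsion exactness of Howard's coefficient rings `A_{m,k} = S_m/p^k` and of the free Eisenstein levels
# `M ⊗ A_{m,k}`: `X[p^b] = p^{a−b} X` (theorems only; no definition, no named fact, no instance)

Topic `NumberTheory/EllipticCurves` (cell `pub/bsd-print-x9`; companion of `IwasawaAlgebraEisensteinQuotientDVRProofs`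
(`S_m = Λ/(T^m + p)` is a DVR), `ZpExtensionEisensteinTowerExactProofs` (`𝔪^{mk} = (p^k)`, `ker ofSpec`) and
`ZpExtensionEisensteinTwistFreeProofs` (the `A_{m,k}`-basis of `M ⊗ A_{m,k}` for `M ≅ (ℤ/p^k)^ι`)).

* `IwasawaAlgebra.natCast_quotient_X_pow_add_C_ne_zero` — `p ≠ 0` in the DVR `S_m`;
* **`EisensteinCoeff.exists_eq_pow_mul_of_pow_mul_eq_zero`** — `A_{m,a}[p^b] ⊆ p^{a−b} A_{m,a}` (`b ≤ a`): lift to the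
  domain `S_m` and cancel `p^b`;
* **`EisensteinCoeff.Twisted.exists_eq_pow_smul_of_pow_smul_eq_zero`** — the same for `M ⊗ A_{m,a}` with `M ≅ (ℤ/p^a)^ι`
  (coordinatewise in the basis `Twisted.basisOfAddEquiv`); `Twisted.pow_smul_eq_zero` — `p^k` kills `M ⊗ A_{m,k}`.

These are the «levels are FREE over `ℤ/p^a`» input of the injectivity of `×p^{b−a} : T_𝔮/p^a → T_𝔮/p^b`
(`ZpExtensionEisensteinTowerDivisionProofs`); torsion exactness FAILS for a general exact tower (constant tower `ℤ/p`).
References: [Howard2004HeegnerKolyvagin] §2.2 (arXiv 1202.6340 §3.2: `S_𝔮`, `T_𝔮/p^k`); [Washington1997] §13.2.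
BSD is not proved by any of this.
-/

noncomputable section

open Function IsLocalRing

/-! ## §2 Torsion exactness of the Eisenstein coefficient rings and levels -/

namespace Literature.NumberTheory.EllipticCurves.IwasawaAlgebra

variable (p : ℕ) [hp : Fact p.Prime]

/-- `p ≠ 0` in `S_m = Λ/(T^m + p)` (`m ≥ 1`): `S_m` is a discrete valuation ring with `𝔪^m = (p)`, and `𝔪 ≠ 0`.
[cite: Howard2004HeegnerKolyvagin, §2.2 (S_𝔮 is a DVR)] [cite: Washington1997, §13.2] -/
theorem natCast_quotient_X_pow_add_C_ne_zero {m : ℕ} (hm : 1 ≤ m) :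
    (p : IwasawaAlgebra p ⧸ Ideal.span {(PowerSeries.X ^ m + PowerSeries.C (p : ℤ_[p]) : IwasawaAlgebra p)}) ≠ 0 := by
  letI := isLocalRing_quotient_X_pow_add_C p hm
  haveI := isDomain_quotient_X_pow_add_C p hm
  intro h
  have h1 := maximalIdeal_pow_mul_eq_span_natCast_pow p hm 1
  rw [mul_one, pow_one, h, Ideal.span_singleton_eq_bot.2 rfl] at h1
  have h2 : maximalIdeal _ = (⊥ : Ideal (IwasawaAlgebra p ⧸
      Ideal.span {(PowerSeries.X ^ m + PowerSeries.C (p : ℤ_[p]) : IwasawaAlgebra p)})) :=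
    (pow_eq_zero_iff (Nat.pos_of_ne_zero (by omega)).ne').mp h1
  exact (isDiscreteValuationRing_quotient_X_pow_add_C p hm).not_a_field' h2

namespace EisensteinCoeff

variable {p}

/-- **Torsion exactness of `A_{m,a} = S_m/p^a`**: `p^b c = 0` with `b ≤ a` forces `c ∈ p^{a−b} A_{m,a}` (lift to the
domain `S_m`, where `p^b s ∈ p^a S_m` gives `s ∈ p^{a−b} S_m` by cancelling `p^b`).
[cite: Howard2004HeegnerKolyvagin, §2.2 (A_{m,k} = S_𝔮/p^k S_𝔮)] -/
theorem exists_eq_pow_mul_of_pow_mul_eq_zero {m : ℕ} (hm : 1 ≤ m) {a b : ℕ} (hba : b ≤ a)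
    (c : EisensteinCoeff p m a) (hc : (p : EisensteinCoeff p m a) ^ b * c = 0) :
    ∃ c' : EisensteinCoeff p m a, c = (p : EisensteinCoeff p m a) ^ (a - b) * c' := by
  haveI := isDomain_quotient_X_pow_add_C p hm
  obtain ⟨s, rfl⟩ := ofSpec_surjective m a c
  have h0 : ofSpec p m a ((p : _) ^ b * s) = 0 := by
    rw [map_mul]
    simpa only [map_pow, map_natCast] using hc
  obtain ⟨c₁, hc₁⟩ := (ofSpec_eq_zero_iff m a _).1 h0
  have hpa : (p : IwasawaAlgebra p ⧸ Ideal.span {(PowerSeries.X ^ m + PowerSeries.C (p : ℤ_[p]) : IwasawaAlgebra p)}) ^ a =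
      (p : _) ^ b * (p : _) ^ (a - b) := by
    rw [← pow_add, Nat.add_sub_cancel' hba]
  have hs : s = c₁ * (p : _) ^ (a - b) := by
    refine mul_left_cancel₀ (pow_ne_zero b (natCast_quotient_X_pow_add_C_ne_zero p hm)) ?_
    rw [hc₁, hpa]; ring
  refine ⟨ofSpec p m a c₁, ?_⟩
  rw [hs, map_mul, mul_comm]
  simp only [map_pow, map_natCast]

/-- **Torsion exactness of a free Eisenstein level**: for `M ≅ (ℤ/p^a)^ι` and `x ∈ M ⊗ A_{m,a}` with `p^b x = 0`,
`b ≤ a`, one has `x ∈ p^{a−b}(M ⊗ A_{m,a})` (coordinates in the basis `Twisted.basisOfAddEquiv`).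
[cite: Howard2004HeegnerKolyvagin, §2.2 (T_𝔮/p^k T_𝔮 free over A_{m,k})] -/
theorem Twisted.exists_eq_pow_smul_of_pow_smul_eq_zero {m : ℕ} (hm : 1 ≤ m) {a b : ℕ} (hba : b ≤ a)
    {M : Type*} [AddCommGroup M] {ι : Type*} [Fintype ι] (e : M ≃+ (ι → ZMod (p ^ a)))
    (x : Twisted p m a M) (hx : p ^ b • x = 0) : ∃ y : Twisted p m a M, x = p ^ (a - b) • y := by
  classical
  set B := Twisted.basisOfAddEquiv (m := m) e with hB
  have hsm : ∀ (n : ℕ) (v : Twisted p m a M), (p : EisensteinCoeff p m a) ^ n • v = p ^ n • v := fun n v ↦ by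
    rw [← Nat.cast_smul_eq_nsmul (EisensteinCoeff p m a) (p ^ n) v]
    simp only [Nat.cast_pow]
  have hx' : ((p : EisensteinCoeff p m a) ^ b) • x = 0 := by rw [hsm]; exact hx
  have hcoord : ∀ i, (p : EisensteinCoeff p m a) ^ b * B.repr x i = 0 := fun i ↦ by
    have h := congrArg (fun z ↦ B.repr z i) hx'
    simp only [map_smul, map_zero, Finsupp.smul_apply, Finsupp.coe_zero, Pi.zero_apply, smul_eq_mul] at h
    exact h
  choose c' hc' using fun i ↦ exists_eq_pow_mul_of_pow_mul_eq_zero hm hba (B.repr x i) (hcoord i)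
  refine ⟨∑ i, c' i • B i, ?_⟩
  calc x = ∑ i, B.repr x i • B i := (B.sum_repr x).symm
    _ = ∑ i, p ^ (a - b) • (c' i • B i) := Finset.sum_congr rfl fun i _ ↦ by
        rw [hc' i, mul_smul, hsm]
    _ = p ^ (a - b) • ∑ i, c' i • B i := (Finset.smul_sum ..).symm

/-- `p^k` kills `M ⊗ A_{m,k}` (`p^k = 0` in `A_{m,k}`). [cite: Howard2004HeegnerKolyvagin, §2.2] -/
theorem Twisted.pow_smul_eq_zero (m k : ℕ) {M : Type*} [AddCommGroup M] (x : Twisted p m k M) :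
    p ^ k • x = 0 := by
  rw [← Nat.cast_smul_eq_nsmul (EisensteinCoeff p m k), Nat.cast_pow]
  have h : ((p : EisensteinCoeff p m k)) ^ k = 0 := by
    have := natCast_prime_pow_eq_zero (p := p) m k
    rwa [Nat.cast_pow] at this
  rw [h, zero_smul]

end EisensteinCoeff

end Literature.NumberTheory.EllipticCurves.IwasawaAlgebra

end
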